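import Summits.NavierStokesRegularity.NavierStokesRegularity.Theorems.ExtremiserTransienceNearExtremalTransienceExtremiserLiouvilleConstantSpeedConvexKKT
import HarnessLib

/-!
# Crux `ExtremiserTransience.NearExtremalTransience` (stmt-NavierStokesRegularity-21883), line `extremiser_liouville`,
# stub K1b — LOCALISED KKT: deleting a region of the residue object costs at least its share of the first variation

`--supports stmt-NavierStokesRegularity-21883` (helper).  Author: prover seat `ns-el-k1b` (g5).  Step (iii) of the
axial-truncation attack on the JET alternative (`Cruxes/NearExtremalTransience/Lines/extremiser_liouville_k1b_jet.md` §4),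
with the solenoidal corrector left ABSTRACT.

Setting: `v` a constant-speed extended extremiser (`‖v‖ ≡ M = ‖c‖`, `|S| = κ⋆M√Z√W`), `V = v − c`, `θ ∈ C^∞_c(ℝ³;[0,1])` the
weight of the region to delete, and a gradient corrector `∇p` (`p ∈ C^∞`, `‖∇p‖ ≤ η`, `‖D∇p‖ ≤ B_p`, `D¹∇p, D²∇p ∈ L²`) making
the truncated field `u := (1 − θ)V + ∇p` divergence free.  Then `‖c + (1−θ)V‖ ≤ (1−θ)‖c + V‖ + θ‖c‖ = M` (convexity of the ball),
so `‖c + u‖ ≤ M + η` and `…ConstantSpeedConvexKKT` applies to `u`; by linearity of the first variations and `curl ∇p = 0`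
(`a₁(∇p) = c₁(∇p) = 0`, `J₁(∇p) = ∫⟪ω, D∇p ω⟫`):

* `firstVariation_smul_ge_of_gradient_corrector` : **`ℓ(θV) ≥ S·∫⟪ω, (D∇p) ω⟫ − κ⋆²·M·Z·W·η`**, i.e.
  `S·J₁(θV) − κ⋆²M²(W a₁(θV) + Z c₁(θV)) ≥ S∫⟪ω, D(∇p)ω⟫ − κ⋆²MZW·η`, where `J₁, a₁, c₁` are the usual first-variation integrals of
  the compactly supported direction `θV`.  Expanding `curl(θV) = θω + ∇θ × V`, `D(θV) = θDV + V ⊗ ∇θ` turns the left side into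
  `3S·S_θ − κ⋆²M²(W Z_θ + Z W_θ) + (∇θ-cross terms)` (`X_θ = ∫θ·(density of X)`), i.e. the record's
  `κ⋆²M²(W Z_θ + Z W_θ) ≤ 3S·S_θ + err`: THE DELETED REGION'S SHARE OF ENSTROPHY + PALINSTROPHY IS PAID FOR BY ITS SHARE OF
  STRETCHING, up to the cut-off cross terms, the pressure-Hessian term `S∫⟪ω, D∇p ω⟫` and the sup excess `κ⋆²MZW‖∇p‖_∞`.

The corrector for `θV` is `∇p = ∇π[θV] = ∇(Γ ∗ div(θV))` (tree `classicalLerayProj`, `…NewtonGradientBound` for `‖∇p‖_∞`,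
`NewtonPotentialGradientFarField` for `D∇p, D²∇p ∈ L²` since `∫div(θV) = 0`); instantiating it is step (ii-b), not done here.

WHAT THIS IS NOT: K1b is NOT proved; nothing here proves NS regularity. [folklore]
-/

noncomputable section

open Set Filter Topology MeasureTheory Metric Function
open scoped ENNReal NNReal Topology InnerProductSpace RealInnerProductSpace ContDiff
open Literature.Analysis.FluidPDE Literature.Analysis

namespace Summit.NavierStokesRegularity.NavierStokesRegularity.Theorems

-- the problem directory repeats the summit name (`NavierStokesRegularity/NavierStokesRegularity`)
set_option linter.dupNamespace false

namespace ExtremiserLiouville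

open DepletionLadder.KStar

variable {v : EuclideanSpace ℝ (Fin 3) → EuclideanSpace ℝ (Fin 3)} {c : EuclideanSpace ℝ (Fin 3)}
  {θ p : EuclideanSpace ℝ (Fin 3) → ℝ}

/-- A `C^∞_c` vector field has `Dᵏ ∈ L²` for every `k`. [folklore] -/
theorem lintegral_iteratedFDeriv_lt_top_of_hasCompactSupport {ψ : EuclideanSpace ℝ (Fin 3) → EuclideanSpace ℝ (Fin 3)}
    (hψ : ContDiff ℝ ∞ ψ) (hψc : HasCompactSupport ψ) (k : ℕ) :
    ∫⁻ x, ‖iteratedFDeriv ℝ k ψ x‖ₑ ^ 2 < ⊤ := by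
  have hc : Continuous (iteratedFDeriv ℝ k ψ) := hψ.continuous_iteratedFDeriv (by exact_mod_cast le_top)
  have hm : MemLp (iteratedFDeriv ℝ k ψ) 2 (volume : Measure (EuclideanSpace ℝ (Fin 3))) :=
    hc.memLp_of_hasCompactSupport (hψc.iteratedFDeriv (𝕜 := ℝ) k)
  exact lintegral_enorm_sq_lt_top_iff_eLpNorm.2 hm.2

/-- The gradient of a `C^∞` scalar is `C^∞` (as a vector field). [folklore] -/
theorem contDiff_gradient_top (hp : ContDiff ℝ ∞ p) : ContDiff ℝ ∞ (gradient p) := by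
  have e : gradient p = fun x => (InnerProductSpace.toDual ℝ (EuclideanSpace ℝ (Fin 3))).symm (fderiv ℝ p x) := rfl
  rw [e]
  exact (InnerProductSpace.toDual ℝ (EuclideanSpace ℝ (Fin 3))).symm.contDiff.comp (contDiff_infty_iff_fderiv.1 hp).2

/-- A gradient is curl free (as a function). [folklore] -/
theorem curl_gradient_fun_eq_zero (hp : ContDiff ℝ ∞ p) : curl (gradient p) = fun _ => 0 :=
  funext fun x => curl_gradient_eq_zero_holds p (hp.of_le (by norm_cast)) x

/-- **LOCALISED KKT (abstract corrector).**  See the module docstring: for a constant-speed extended extremiser `v`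
(`‖v‖ ≡ M = ‖c‖`), a weight `θ ∈ C^∞_c`, `0 ≤ θ ≤ 1`, and a smooth gradient corrector `∇p` (`‖∇p‖ ≤ η`, `‖D∇p‖ ≤ B_p`,
`D¹∇p, D²∇p ∈ L²`) with `div((1−θ)(v−c) + ∇p) = 0`:
`S·J₁(θ(v−c)) − κ⋆²M²(W·a₁(θ(v−c)) + Z·c₁(θ(v−c))) ≥ S·∫⟪ω, D(∇p) ω⟫ − κ⋆²·M·Z·W·η`. [folklore] -/
theorem firstVariation_smul_ge_of_gradient_corrector
    (hv : ContDiff ℝ ∞ v) (hdiv : VectorCalculus.IsDivFree v) {M B : ℝ} (hMpos : 0 < M)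
    (hM : ∀ x, ‖v x‖ = M) (hcM : ‖c‖ = M) (hB : ∀ x, ‖fderiv ℝ v x‖ ≤ B)
    (h1 : ∫⁻ x, ‖iteratedFDeriv ℝ 1 v x‖ₑ ^ 2 < ⊤) (h2 : ∫⁻ x, ‖iteratedFDeriv ℝ 2 v x‖ₑ ^ 2 < ⊤)
    (hatt : |∫ x, ⟪curl v x, fderiv ℝ v x (curl v x)⟫| = (sInf {κ : ℝ | (∀ (v : EuclideanSpace ℝ (Fin 3) → EuclideanSpace ℝ (Fin 3)) (M B : ℝ), ContDiff ℝ (⊤ : ℕ∞) v → Literature.Analysis.FluidPDE.VectorCalculus.IsDivFree v → (∀ x, ‖v x‖ ≤ M) → (∀ x, ‖fderiv ℝ v x‖ ≤ B) → (∫⁻ x, ‖iteratedFDeriv ℝ 0 v x‖ₑ ^ 2 < ⊤) → (∫⁻ x, ‖iteratedFDeriv ℝ 1 v x‖ₑ ^ 2 < ⊤) → (∫⁻ x, ‖iteratedFDeriv ℝ 2 v x‖ₑ ^ 2 < ⊤) → |∫ x, ⟪Literature.Analysis.FluidPDE.curl v x, fderiv ℝ v x (Literature.Analysis.FluidPDE.curl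 v x)⟫_ℝ| ≤ κ * M * Real.sqrt (∫ x, ‖Literature.Analysis.FluidPDE.curl v x‖ ^ 2) * Real.sqrt (∫ x, Literature.Analysis.FluidPDE.frobeniusNormSq (fderiv ℝ (Literature.Analysis.FluidPDE.curl v) x)))}) * M * Real.sqrt (∫ x, ‖curl v x‖ ^ 2) * Real.sqrt (∫ x, frobeniusNormSq (fderiv ℝ (curl v) x)))
    (hθ : ContDiff ℝ ∞ θ) (hθc : HasCompactSupport θ) (hθ01 : ∀ x, 0 ≤ θ x ∧ θ x ≤ 1)
    (hp : ContDiff ℝ ∞ p) {η Bp : ℝ} (hpη : ∀ x, ‖gradient p x‖ ≤ η) (hpB : ∀ x, ‖fderiv ℝ (gradient p) x‖ ≤ Bp)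
    (hp1 : ∫⁻ x, ‖iteratedFDeriv ℝ 1 (gradient p) x‖ₑ ^ 2 < ⊤) (hp2 : ∫⁻ x, ‖iteratedFDeriv ℝ 2 (gradient p) x‖ₑ ^ 2 < ⊤)
    (hudiv : VectorCalculus.IsDivFree (fun x => (1 - θ x) • (v x - c) + gradient p x)) :
    (∫ x, ⟪curl v x, fderiv ℝ v x (curl v x)⟫) *
        (∫ x, (⟪curl (fun y => θ y • (v y - c)) x, fderiv ℝ v x (curl v x)⟫ +
          ⟪curl v x, fderiv ℝ (fun y => θ y • (v y - c)) x (curl v x)⟫ + ⟪curl v x, fderiv ℝ v x (curl (fun y => θ y • (v y - c)) x)⟫)) -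
      (sInf {κ : ℝ | (∀ (v : EuclideanSpace ℝ (Fin 3) → EuclideanSpace ℝ (Fin 3)) (M B : ℝ), ContDiff ℝ (⊤ : ℕ∞) v → Literature.Analysis.FluidPDE.VectorCalculus.IsDivFree v → (∀ x, ‖v x‖ ≤ M) → (∀ x, ‖fderiv ℝ v x‖ ≤ B) → (∫⁻ x, ‖iteratedFDeriv ℝ 0 v x‖ₑ ^ 2 < ⊤) → (∫⁻ x, ‖iteratedFDeriv ℝ 1 v x‖ₑ ^ 2 < ⊤) → (∫⁻ x, ‖iteratedFDeriv ℝ 2 v x‖ₑ ^ 2 < ⊤) → |∫ x, ⟪Literature.Analysis.FluidPDE.curl v x, fderiv ℝ v x (Literature.Analysis.FluidPDE.curl v x)⟫_ℝ| ≤ κ * M * Real.sqrt (∫ x, ‖Literature.Analysis.FluidPDE.curl v x‖ ^ 2) * Real.sqrt (∫ x, Literature.Analysis.FluidPDE.frobeniusNormSq (fderiv ℝ (Literature.Analysis.FluidPDE.curl v) x)))}) ^ 2 * M ^ 2 * ((∫ x, frobeniusNormSq (fderiv ℝ (curl v) x)) * (∫ x, ⟪curl v x, curl (fun y => θ y • (v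 y - c)) x⟫) +
        (∫ x, ‖curl v x‖ ^ 2) * (∫ x, ∑ i, ⟪fderiv ℝ (curl v) x (EuclideanSpace.basisFun (Fin 3) ℝ i), fderiv ℝ (curl (fun y => θ y • (v y - c))) x (EuclideanSpace.basisFun (Fin 3) ℝ i)⟫)) ≥
      (∫ x, ⟪curl v x, fderiv ℝ v x (curl v x)⟫) * (∫ x, ⟪curl v x, fderiv ℝ (gradient p) x (curl v x)⟫) -
        (sInf {κ : ℝ | (∀ (v : EuclideanSpace ℝ (Fin 3) → EuclideanSpace ℝ (Fin 3)) (M B : ℝ), ContDiff ℝ (⊤ : ℕ∞) v → Literature.Analysis.FluidPDE.VectorCalculus.IsDivFree v → (∀ x, ‖v x‖ ≤ M) → (∀ x, ‖fderiv ℝ v x‖ ≤ B) → (∫⁻ x, ‖iteratedFDeriv ℝ 0 v x‖ₑ ^ 2 < ⊤) → (∫⁻ x, ‖iteratedFDeriv ℝ 1 v x‖ₑ ^ 2 < ⊤) → (∫⁻ x, ‖iteratedFDeriv ℝ 2 v x‖ₑ ^ 2 < ⊤) → |∫ x, ⟪Literature.Analysis.FluidPDE.curl v x, fderiv ℝ v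 x (Literature.Analysis.FluidPDE.curl v x)⟫_ℝ| ≤ κ * M * Real.sqrt (∫ x, ‖Literature.Analysis.FluidPDE.curl v x‖ ^ 2) * Real.sqrt (∫ x, Literature.Analysis.FluidPDE.frobeniusNormSq (fderiv ℝ (Literature.Analysis.FluidPDE.curl v) x)))}) ^ 2 * M * (∫ x, ‖curl v x‖ ^ 2) * (∫ x, frobeniusNormSq (fderiv ℝ (curl v) x)) * η := by
  set K : ℝ := (sInf {κ : ℝ | (∀ (v : EuclideanSpace ℝ (Fin 3) → EuclideanSpace ℝ (Fin 3)) (M B : ℝ), ContDiff ℝ (⊤ : ℕ∞) v → Literature.Analysis.FluidPDE.VectorCalculus.IsDivFree v → (∀ x, ‖v x‖ ≤ M) → (∀ x, ‖fderiv ℝ v x‖ ≤ B) → (∫⁻ x, ‖iteratedFDeriv ℝ 0 v x‖ₑ ^ 2 < ⊤) → (∫⁻ x, ‖iteratedFDeriv ℝ 1 v x‖ₑ ^ 2 < ⊤) → (∫⁻ x, ‖iteratedFDeriv ℝ 2 v x‖ₑ ^ 2 < ⊤) → |∫ x, ⟪Literature.Analysis.FluidPDE.curl v x, fderiv ℝ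 v x (Literature.Analysis.FluidPDE.curl v x)⟫_ℝ| ≤ κ * M * Real.sqrt (∫ x, ‖Literature.Analysis.FluidPDE.curl v x‖ ^ 2) * Real.sqrt (∫ x, Literature.Analysis.FluidPDE.frobeniusNormSq (fderiv ℝ (Literature.Analysis.FluidPDE.curl v) x)))}) with hK
  -- the three pieces `V = v − c`, `ψ = θ V`, `q = ∇p`, and the competitor `u = V − ψ + q`
  set V : EuclideanSpace ℝ (Fin 3) → EuclideanSpace ℝ (Fin 3) := fun y => v y - c with hVdef
  set ψ : EuclideanSpace ℝ (Fin 3) → EuclideanSpace ℝ (Fin 3) := fun y => θ y • (v y - c) with hψdef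
  set q : EuclideanSpace ℝ (Fin 3) → EuclideanSpace ℝ (Fin 3) := gradient p with hqdef
  set u₁ : EuclideanSpace ℝ (Fin 3) → EuclideanSpace ℝ (Fin 3) := fun y => V y + (-1 : ℝ) • ψ y with hu₁def
  set u : EuclideanSpace ℝ (Fin 3) → EuclideanSpace ℝ (Fin 3) := fun y => u₁ y + (1 : ℝ) • q y with hudef
  have hu_eq : (fun x => (1 - θ x) • (v x - c) + gradient p x) = u := by
    funext x; simp only [hudef, hu₁def, hVdef, hψdef, hqdef, sub_smul, one_smul, neg_one_smul]; abel
  have hvd : Differentiable ℝ v := hv.differentiable (by simp)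
  have hV : ContDiff ℝ ∞ V := hv.sub contDiff_const
  have hVd : Differentiable ℝ V := hV.differentiable (by simp)
  have hψ : ContDiff ℝ ∞ ψ := hθ.smul hV
  have hψd : Differentiable ℝ ψ := hψ.differentiable (by simp)
  have hψc : HasCompactSupport ψ := hθc.smul_right
  have hq : ContDiff ℝ ∞ q := contDiff_gradient_top hp
  have hqd : Differentiable ℝ q := hq.differentiable (by simp)
  have hu₁ : ContDiff ℝ ∞ u₁ := hV.add (hψ.const_smul _)
  have hu₁d : Differentiable ℝ u₁ := hu₁.differentiable (by simp)
  have hu : ContDiff ℝ ∞ u := hu₁.add (hq.const_smul _)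
  have hDV : ∀ x, fderiv ℝ V x = fderiv ℝ v x := fun x => by simp only [hVdef]; rw [fderiv_sub_const]
  have hcurlV : curl V = curl v := curl_sub_const v c
  have hcurlq : curl q = fun _ => 0 := by rw [hqdef]; exact curl_gradient_fun_eq_zero hp
  -- `u` is in the global class
  have hudiv' : VectorCalculus.IsDivFree u := by rw [← hu_eq]; exact hudiv
  obtain ⟨Cψ, hCψ⟩ := (hψ.continuous_fderiv (by simp)).bounded_above_of_compact_support (hψc.fderiv (𝕜 := ℝ))
  have hDu : ∀ x, fderiv ℝ u x = fderiv ℝ v x - fderiv ℝ ψ x + fderiv ℝ q x := fun x => by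
    rw [hudef, fderiv_add_smul hu₁d hqd, hu₁def, fderiv_add_smul hVd hψd, hDV]
    module
  have huC : ∀ x, ‖fderiv ℝ u x‖ ≤ B + Cψ + Bp := fun x => by
    rw [hDu]
    calc ‖fderiv ℝ v x - fderiv ℝ ψ x + fderiv ℝ q x‖ ≤ ‖fderiv ℝ v x - fderiv ℝ ψ x‖ + ‖fderiv ℝ q x‖ := norm_add_le _ _
      _ ≤ ‖fderiv ℝ v x‖ + ‖fderiv ℝ ψ x‖ + ‖fderiv ℝ q x‖ := by gcongr; exact norm_sub_le _ _
      _ ≤ B + Cψ + Bp := add_le_add (add_le_add (hB x) (hCψ x)) (hpB x)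
  have hVk : ∀ k : ℕ, k ≠ 0 → (∫⁻ x, ‖iteratedFDeriv ℝ k v x‖ₑ ^ 2 < ⊤) → ∫⁻ x, ‖iteratedFDeriv ℝ k V x‖ₑ ^ 2 < ⊤ := by
    intro k hk hkv
    have e : (fun x => ‖iteratedFDeriv ℝ k V x‖ₑ ^ 2) = fun x => ‖iteratedFDeriv ℝ k v x‖ₑ ^ 2 := by
      funext x; rw [iteratedFDeriv_sub_const_of_ne hv c hk]
    rw [e]; exact hkv
  have hψk : ∀ k : ℕ, ∫⁻ x, ‖iteratedFDeriv ℝ k ψ x‖ₑ ^ 2 < ⊤ := lintegral_iteratedFDeriv_lt_top_of_hasCompactSupport hψ hψc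
  have hu₁1 : ∫⁻ x, ‖iteratedFDeriv ℝ 1 u₁ x‖ₑ ^ 2 < ⊤ :=
    lintegral_iteratedFDeriv_add_smul_lt_top_global hV hψ (-1) (hVk 1 one_ne_zero h1) (hψk 1)
  have hu₁2 : ∫⁻ x, ‖iteratedFDeriv ℝ 2 u₁ x‖ₑ ^ 2 < ⊤ :=
    lintegral_iteratedFDeriv_add_smul_lt_top_global hV hψ (-1) (hVk 2 two_ne_zero h2) (hψk 2)
  have hu1 : ∫⁻ x, ‖iteratedFDeriv ℝ 1 u x‖ₑ ^ 2 < ⊤ := lintegral_iteratedFDeriv_add_smul_lt_top_global hu₁ hq 1 hu₁1 hp1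
  have hu2 : ∫⁻ x, ‖iteratedFDeriv ℝ 2 u x‖ₑ ^ 2 < ⊤ := lintegral_iteratedFDeriv_add_smul_lt_top_global hu₁ hq 1 hu₁2 hp2
  -- the sup bound `‖c + u‖ ≤ M + η`
  have hball : ∀ x, ‖c + u x‖ ≤ M + η := fun x => by
    have e : c + u x = ((1 - θ x) • v x + θ x • c) + q x := by
      simp only [hudef, hu₁def, hVdef, hψdef, smul_sub, sub_smul, one_smul, neg_one_smul]; abel
    rw [e]
    have h01 := hθ01 x
    calc ‖(1 - θ x) • v x + θ x • c + q x‖ ≤ ‖(1 - θ x) • v x + θ x • c‖ + ‖q x‖ := norm_add_le _ _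
      _ ≤ (‖(1 - θ x) • v x‖ + ‖θ x • c‖) + η := add_le_add (norm_add_le _ _) (hpη x)
      _ = (1 - θ x) * M + θ x * M + η := by
          rw [norm_smul, norm_smul, Real.norm_eq_abs, Real.norm_eq_abs, abs_of_nonneg (by linarith), abs_of_nonneg h01.1,
            hM, hcM]
      _ = M + η := by ring
  -- the convex-set KKT inequality for `u`
  have hmain := firstVariation_le_of_norm_add_le_global hv hdiv hMpos hM hB h1 h2 hatt hu hudiv' huC hu1 hu2 hball
  -- split the first variations of `u = V − ψ + q`
  have hBV : ∀ x, ‖fderiv ℝ V x‖ ≤ B := fun x => by rw [hDV]; exact hB x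
  obtain ⟨iV1, -, -⟩ := integrable_stretching_coeffs_global hv hV hB hBV h1 (hVk 1 one_ne_zero h1)
  obtain ⟨iψ1, -, -⟩ := integrable_stretching_coeffs hv hψ hψc
  obtain ⟨iq1, -, -⟩ := integrable_stretching_coeffs_global hv hq hB hpB h1 hp1
  obtain ⟨aV, -⟩ := integrable_enstrophy_coeffs_global hv hV h1 (hVk 1 one_ne_zero h1)
  obtain ⟨aψ, -⟩ := integrable_enstrophy_coeffs hv hψ hψc
  obtain ⟨cV, -⟩ := integrable_palinstrophy_coeffs_global hv hV h2 (hVk 2 two_ne_zero h2)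
  obtain ⟨cψ, -⟩ := integrable_palinstrophy_coeffs hv hψ hψc
  have hcurlu : ∀ x, curl u x = curl v x - curl ψ x := fun x => by
    rw [hudef, curl_add_smul hu₁d hqd, hu₁def, curl_add_smul hVd hψd, hcurlV, hcurlq]
    beta_reduce
    rw [smul_zero, add_zero]
    module
  have hDu' : ∀ x w, fderiv ℝ u x w = fderiv ℝ v x w - fderiv ℝ ψ x w + fderiv ℝ q x w := fun x w => by
    rw [hDu]; rfl
  have hDcurlu : ∀ x w, fderiv ℝ (curl u) x w = fderiv ℝ (curl v) x w - fderiv ℝ (curl ψ) x w := fun x w => by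
    have e : curl u = fun x => curl v x + (-1 : ℝ) • curl ψ x := by
      funext x; rw [hcurlu, neg_one_smul, sub_eq_add_neg]
    have hcv : ContDiff ℝ ∞ (curl v) := contDiff_curl_top hv
    have hcψ : ContDiff ℝ ∞ (curl ψ) := contDiff_curl_top hψ
    have e2 : fderiv ℝ (curl u) x = fderiv ℝ (curl v) x - fderiv ℝ (curl ψ) x := by
      rw [e, fderiv_add_smul (hcv.differentiable (by simp)) (hcψ.differentiable (by simp))]
      module
    rw [e2]; rfl
  -- J₁(u) = 3S − J₁(ψ) + ∫⟪ω, Dq ω⟫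
  have i0 := integrable_stretching hv hB h1
  have eJ : (∫ x, (⟪curl u x, fderiv ℝ v x (curl v x)⟫ + ⟪curl v x, fderiv ℝ u x (curl v x)⟫ + ⟪curl v x, fderiv ℝ v x (curl u x)⟫)) =
      3 * (∫ x, ⟪curl v x, fderiv ℝ v x (curl v x)⟫) -
        (∫ x, (⟪curl ψ x, fderiv ℝ v x (curl v x)⟫ + ⟪curl v x, fderiv ℝ ψ x (curl v x)⟫ + ⟪curl v x, fderiv ℝ v x (curl ψ x)⟫)) +
        ∫ x, ⟪curl v x, fderiv ℝ q x (curl v x)⟫ := by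
    have iq : Integrable (fun x => ⟪curl v x, fderiv ℝ q x (curl v x)⟫) volume := by
      have := integrable_stretching_coeffs_global hv hq hB hpB h1 hp1
      -- the middle coefficient alone: bounded `Dq` between two `L²` factors
      exact RungReynoldsOne.WeightedSlice.integrable_of_norm_le_const_mul_mul Bp
        ((continuous_curl (hv.of_le (by norm_cast))).inner (((hq.continuous_fderiv (by simp))).clm_apply
          (continuous_curl (hv.of_le (by norm_cast)))))
        (continuous_curl (hv.of_le (by norm_cast))) (continuous_curl (hv.of_le (by norm_cast)))
        (DepletionLadder.KStar.lintegral_enorm_curl_sq_lt_top hv h1) (DepletionLadder.KStar.lintegral_enorm_curl_sq_lt_top hv h1)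
        fun x => by
          calc ‖⟪curl v x, fderiv ℝ q x (curl v x)⟫‖ ≤ ‖curl v x‖ * ‖fderiv ℝ q x (curl v x)‖ := norm_inner_le_norm _ _
            _ ≤ ‖curl v x‖ * (Bp * ‖curl v x‖) :=
                mul_le_mul_of_nonneg_left ((fderiv ℝ q x).le_of_opNorm_le (hpB x) _) (norm_nonneg _)
            _ = Bp * ‖curl v x‖ * ‖curl v x‖ := by ring
    have hpt : ∀ x, ⟪curl u x, fderiv ℝ v x (curl v x)⟫ + ⟪curl v x, fderiv ℝ u x (curl v x)⟫ + ⟪curl v x, fderiv ℝ v x (curl u x)⟫ =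
        (3 * ⟪curl v x, fderiv ℝ v x (curl v x)⟫ -
          (⟪curl ψ x, fderiv ℝ v x (curl v x)⟫ + ⟪curl v x, fderiv ℝ ψ x (curl v x)⟫ + ⟪curl v x, fderiv ℝ v x (curl ψ x)⟫)) +
          ⟪curl v x, fderiv ℝ q x (curl v x)⟫ := by
      intro x
      simp only [hcurlu, hDu', inner_sub_left, inner_sub_right, inner_add_right, map_sub]
      ring
    have i3 : Integrable (fun x => 3 * ⟪curl v x, fderiv ℝ v x (curl v x)⟫) volume := i0.const_mul 3
    have i3ψ : Integrable (fun x => 3 * ⟪curl v x, fderiv ℝ v x (curl v x)⟫ -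
        (⟪curl ψ x, fderiv ℝ v x (curl v x)⟫ + ⟪curl v x, fderiv ℝ ψ x (curl v x)⟫ + ⟪curl v x, fderiv ℝ v x (curl ψ x)⟫)) volume :=
      i3.sub iψ1
    rw [integral_congr_ae (Eventually.of_forall hpt), integral_add i3ψ iq, integral_sub i3 iψ1, integral_const_mul]
  have eA : (∫ x, ⟪curl v x, curl u x⟫) = (∫ x, ‖curl v x‖ ^ 2) - ∫ x, ⟪curl v x, curl ψ x⟫ := by
    have i00 : Integrable (fun x => ‖curl v x‖ ^ 2) volume := (integrable_norm_curl_sq (hv.of_le (by norm_cast)) h1).1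
    have hpt : ∀ x, ⟪curl v x, curl u x⟫ = ‖curl v x‖ ^ 2 - ⟪curl v x, curl ψ x⟫ := fun x => by
      rw [hcurlu, inner_sub_right, real_inner_self_eq_norm_sq]
    rw [integral_congr_ae (Eventually.of_forall hpt), integral_sub i00 aψ]
  have eC : (∫ x, ∑ i, ⟪fderiv ℝ (curl v) x (EuclideanSpace.basisFun (Fin 3) ℝ i), fderiv ℝ (curl u) x (EuclideanSpace.basisFun (Fin 3) ℝ i)⟫) =
      (∫ x, frobeniusNormSq (fderiv ℝ (curl v) x)) -
        ∫ x, ∑ i, ⟪fderiv ℝ (curl v) x (EuclideanSpace.basisFun (Fin 3) ℝ i), fderiv ℝ (curl ψ) x (EuclideanSpace.basisFun (Fin 3) ℝ i)⟫ := by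
    have i00 : Integrable (fun x => frobeniusNormSq (fderiv ℝ (curl v) x)) volume :=
      (integrable_frobeniusNormSq_fderiv_curl (hv.of_le (by norm_cast)) h2).1
    have hpt : ∀ x, (∑ i, ⟪fderiv ℝ (curl v) x (EuclideanSpace.basisFun (Fin 3) ℝ i), fderiv ℝ (curl u) x (EuclideanSpace.basisFun (Fin 3) ℝ i)⟫) =
        frobeniusNormSq (fderiv ℝ (curl v) x) -
          ∑ i, ⟪fderiv ℝ (curl v) x (EuclideanSpace.basisFun (Fin 3) ℝ i), fderiv ℝ (curl ψ) x (EuclideanSpace.basisFun (Fin 3) ℝ i)⟫ := by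
      intro x
      rw [frobeniusNormSq_eq_sum (EuclideanSpace.basisFun (Fin 3) ℝ), ← Finset.sum_sub_distrib]
      exact Finset.sum_congr rfl fun i _ => by rw [hDcurlu, inner_sub_right, real_inner_self_eq_norm_sq]
    rw [integral_congr_ae (Eventually.of_forall hpt), integral_sub i00 cψ]
  rw [eJ, eA, eC] at hmain
  -- algebra
  nlinarith [hmain]

end ExtremiserLiouville

end Summit.NavierStokesRegularity.NavierStokesRegularity.Theorems

end
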